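import Literature.Computability.Complexity.RossmanMonotoneCliqueSparseNoiseAsymptotic
import Literature.Computability.Complexity.RossmanMonotoneCliqueThm2Proofs
import HarnessLib

/-!
# Rossman 2010, Theorem 1 with sparse noise, relative to an arbitrary background graph

Two immediate corollaries of the in-tree **sparse-noise variant** `thm1_sparse_natSize`
(`RossmanMonotoneCliqueSparseNoiseAsymptotic.lean`) of Theorem 1 of

* B. Rossman, *The monotone complexity of k-clique on random graphs*, FOCS 2010, pp. 193–201
  (full version 2009; SIAM J. Comput. 43 (2014) 256–279), Theorem 1 (p. 4) [Rossman2010]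

(the variant decouples the class parameter `k'` from the clique size `k` and replaces Lemma 15
by a count of the non-empty small minterms of the output; it reads: for `5 ≤ k'`,
`4(c+1) ≤ k' ≤ k`, `0 < ρ`, `0 < δ`, `ρ + δ ≤ 2/k'`, `η > 0` and all large `n`, every circuit `C`
over `{∧₂, ∨₂, 0, 1}` on the edges of `Kₙ` with `size C ≤ n ^ c` and `Pr_A[C(K_A) = 1] ≥ η`
has `Pr[C(G(n, n^{-ρ})) = 1] ≥ 1 - exp(-n^{δ/2})`), obtained by applying it to the
**restriction** `C^x : y ↦ C(x ∨ y)` of `C` at a fixed background graph `x`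
(`Circuit.exists_restrict_sup` of `RossmanMonotoneCliqueThm2Proofs.lean`, the device of §7 of
the paper: relabel the inputs in `E(x)` by the constant `1`; this costs at most one extra gate,
absorbed here by `n ^ c + 1 ≤ n ^ (c + 1)` for `n ≥ 2`, whence the class hypothesis
`4(c+2) ≤ k'` in place of `4(c+1) ≤ k'`).

* `thm1_sparse_relative` — **the sparse-noise Theorem 1 relative to an arbitrary background**:
  for all large `n`, every monotone circuit `C` of size `≤ n ^ c` and ANY background graph `x`,
  `Pr_A[C(x ∪ K_A) = 1] ≤ η + e^{-n^{δ/2}} + Pr_{y ∼ G(n, n^{-ρ})}[C(x ∪ y) = 1]`.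
* `rsd_at_sparse_dose` — the same inequality **averaged over a random background**
  `x ∼ G(n, q)` (any `0 ≤ q ≤ 1`), written out as finite weighted sums against the weights
  `gnpWeight n q x = q^{e(x)} (1-q)^{C(n,2)-e(x)}`:
  `E_x[Pr_A[C(x ∪ K_A) = 1]] - E_x E_y[[C(x ∪ y) = 1]] ≤ η + e^{-n^{δ/2}}`.

Informal reading: for monotone circuits of size `n^c` and all `k ≥ k' ≥ 4(c+2)`, ON TOP OF ANY
BACKGROUND GRAPH, a planted `k`-clique triggers the circuit no more (up to `η + e^{-n^{δ/2}}`)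
than a fresh, independent sprinkle `G(n, n^{-ρ})` does, for every `ρ < 2/k'` — a sprinkle
exponent depending on the size exponent `c` only, NOT on `k`. In the language of the "relative
sparse-dose dial" studied under route PneNP/OneSlice (crux `SingleThreshold`, line
`two-round-exposure`; `Cruxes/SingleThreshold/Ideas/relative-sparse-dose-dial.md`), whose
sprinkle is `G(n, n^{-σ})`, this is the first `k`-independent point `σ = ρ < 1/(2(c+2))` of the
dial; the dial's sparse end `σ > 1 + 1/(k-1)` (a sprinkle too sparse to contain anything but
isolated edges near a `k`-set) is equivalent to Rossman's open single-threshold problem (§1 of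
the paper). Only the point `σ < 2/k'` is a theorem here; nothing about sparser doses is claimed.

Remark (prose only, not formalised): the pointwise form is essentially tight in `ρ` up to the
constant — by Theorem 3 of the paper (monotone circuits of size `n^{k/4 + O(1)}` computing
`k`-clique a.a.s. on `G(n, p)` for every `p(n)`), there are size-`n^c` monotone circuits for
`(4c - O(1))`-cliques which, at the empty background `x = ∅`, accept every planted clique but
reject the sprinkle `G(n, n^{-ρ})` a.a.s. as soon as `ρ` is a constant factor above `2/k'`.

Here `k`, `k'`, `c`, `ρ`, `δ`, `η` are constants and the threshold in `n` depends on all of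
them (uniformly in the background `x`, the background density `q` and the circuit `C`).

Provenance: corollaries of the sparse-noise variant `thm1_sparse_natSize` of Theorem 1 (whose
I-count replacing Lemma 15 is not in the source) via the restriction device of §7; tagged as
corollaries of Theorem 1.

## References

* [Rossman2010] B. Rossman, The monotone complexity of k-clique on random graphs, FOCS 2010,
  193–201; SIAM J. Comput. 43 (2014) 256–279 — Theorem 1 (p. 4), §6 (pp. 8–9), §7 (p. 10),
  Theorem 3 (p. 4).
-/

noncomputable section

namespace Literature.Computability.Complexity

open Finset Filter
open scoped Classical

/-- One extra gate is absorbed by one extra power: `n ^ c + 1 ≤ n ^ (c + 1)` for `n ≥ 2`.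
[folklore] -/
private theorem pow_add_one_le_pow_succ {n c : ℕ} (hn2 : 2 ≤ n) : n ^ c + 1 ≤ n ^ (c + 1) := by
  have h1 : 1 ≤ n ^ c := Nat.one_le_pow _ _ (by omega)
  calc n ^ c + 1 ≤ n ^ c + n ^ c := Nat.add_le_add_left h1 _
    _ = n ^ c * 2 := (Nat.mul_two _).symm
    _ ≤ n ^ c * n := Nat.mul_le_mul_left _ hn2
    _ = n ^ (c + 1) := (Nat.pow_succ _ _).symm

/-- **Rossman 2010, Theorem 1 with sparse noise, relative to an arbitrary background graph**
(corollary of the sparse-noise variant `thm1_sparse_natSize` of Theorem 1, applied to the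
restriction `C^x(y) = C(x ∨ y)` of §7): for `5 ≤ k'`, `4(c+2) ≤ k' ≤ k`, `0 < ρ`, `0 < δ`,
`ρ + δ ≤ 2/k'`, `η > 0`, for all large `n`, every circuit `C` over `{∧₂, ∨₂, 0, 1}` on the
edges of `Kₙ` with `size C ≤ n ^ c` and ANY edge vector `x` satisfy
`Pr_A[C(x ∪ K_A) = 1] ≤ η + exp(-n^{δ/2}) + Pr_{y ∼ G(n, n^{-ρ})}[C(x ∪ y) = 1]`:
on top of any background, a planted random `k`-clique is accepted at most `η + e^{-n^{δ/2}}`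
more often than a fresh sprinkle of density `n^{-ρ}`, for every `ρ < 2/k'` (independent of
`k`). Proof: either `Pr_A[C(x ∪ K_A) = 1] < η`, or `thm1_sparse_natSize` (at size exponent
`c + 1`) applies to `C^x` (`Circuit.exists_restrict_sup`, size `≤ size C + 1 ≤ n ^ (c+1)` for
`n ≥ 2`). [cite: Rossman2010, Thm 1 (p. 4)] -/
theorem thm1_sparse_relative {c k k' : ℕ} {ρ δ η : ℝ} (hk' : 5 ≤ k') (hck' : 4 * (c + 2) ≤ k')
    (hk'k : k' ≤ k) (hρ : 0 < ρ) (hδ : 0 < δ) (hρδ : ρ + δ ≤ 2 / (k' : ℝ)) (hη : 0 < η) :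
    ∀ᶠ n : ℕ in atTop, ∀ C : Circuit ((⊤ : SimpleGraph (Fin n)).edgeSet),
      C.IsOver monotoneBasis01 → C.size ≤ n ^ c →
      ∀ x : (⊤ : SimpleGraph (Fin n)).edgeSet → Bool,
        kSubsetProb n k (fun A => C.eval (x ⊔ cliqueVec A) = true) ≤
          η + Real.exp (-((n : ℝ) ^ (δ / 2))) +
            gnpProb n ((n : ℝ) ^ (-ρ)) (univ.filter fun y => C.eval (x ⊔ y) = true) := by
  have hck'' : 4 * (c + 1 + 1) ≤ k' := by omega
  filter_upwards [thm1_sparse_natSize (c := c + 1) (k := k) hk' hck'' hk'k hρ hδ hρδ hη,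
    eventually_ge_atTop 2] with n hn hn2 C hC hsize x
  have hnr : (1 : ℝ) ≤ n := by exact_mod_cast (show 1 ≤ n by omega)
  have hexp := Real.exp_pos (-((n : ℝ) ^ (δ / 2)))
  have hp0 : 0 ≤ (n : ℝ) ^ (-ρ) := Real.rpow_nonneg (Nat.cast_nonneg n) _
  have hp1 : (n : ℝ) ^ (-ρ) ≤ 1 := Real.rpow_le_one_of_one_le_of_nonpos hnr (by linarith)
  have hg0 := gnpProb_nonneg hp0 hp1 (univ.filter fun y => C.eval (x ⊔ y) = true)
  by_cases hacc : η ≤ kSubsetProb n k (fun A => C.eval (x ⊔ cliqueVec A) = true)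
  · -- the restriction `C^x` is admissible in the sparse-noise Theorem 1 at exponent `c + 1`
    obtain ⟨C', hC', hsize', heval⟩ := C.exists_restrict_sup hC x
    have hsize'' : C'.size ≤ n ^ (c + 1) :=
      hsize'.trans ((Nat.add_le_add_right hsize 1).trans (pow_add_one_le_pow_succ hn2))
    have hkA : kSubsetProb n k (fun A => C'.eval (cliqueVec A) = true) =
        kSubsetProb n k (fun A => C.eval (x ⊔ cliqueVec A) = true) :=
      kSubsetProb_congr fun A => by rw [heval]
    have hf : (univ.filter fun y => C'.eval y = true) =
        univ.filter fun y => C.eval (x ⊔ y) = true :=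
      Finset.filter_congr fun y _ => by rw [heval]
    have key := hn C' hC' hsize'' (hacc.trans_eq hkA.symm)
    rw [hf] at key
    have h1 := kSubsetProb_le_one n k (fun A => C.eval (x ⊔ cliqueVec A) = true)
    linarith
  · rw [not_le] at hacc
    linarith

/-- **The sparse-noise Theorem 1 relative to a random background, averaged** (corollary of
Theorem 1 via `thm1_sparse_relative`; the `k`-independent point `σ = ρ < 2/k'` of the relative
sparse-dose dial of route PneNP/OneSlice, crux `SingleThreshold`): for `5 ≤ k'`,
`4(c+2) ≤ k' ≤ k`, `0 < ρ`, `0 < δ`, `ρ + δ ≤ 2/k'`, `η > 0`, for all large `n`, every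
`0 ≤ q ≤ 1` and every circuit `C` over `{∧₂, ∨₂, 0, 1}` on the edges of `Kₙ` with
`size C ≤ n ^ c`,
`E_{x ∼ G(n,q)}[Pr_A[C(x ∪ K_A) = 1]] - E_{x ∼ G(n,q)} E_{y ∼ G(n,n^{-ρ})}[[C(x ∪ y) = 1]]
  ≤ η + exp(-n^{δ/2})`,
both expectations written as finite sums against the weights `gnpWeight`. Proof: multiply
`thm1_sparse_relative` by `gnpWeight n q x ≥ 0`, sum over `x`, and use `Σ_x gnpWeight n q x = 1`.
[cite: Rossman2010, Thm 1 (p. 4)] -/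
theorem rsd_at_sparse_dose {c k k' : ℕ} {ρ δ η : ℝ} (hk' : 5 ≤ k') (hck' : 4 * (c + 2) ≤ k')
    (hk'k : k' ≤ k) (hρ : 0 < ρ) (hδ : 0 < δ) (hρδ : ρ + δ ≤ 2 / (k' : ℝ)) (hη : 0 < η) :
    ∀ᶠ n : ℕ in atTop, ∀ q : ℝ, 0 ≤ q → q ≤ 1 →
      ∀ C : Circuit ((⊤ : SimpleGraph (Fin n)).edgeSet),
      C.IsOver monotoneBasis01 → C.size ≤ n ^ c →
      (∑ x : (⊤ : SimpleGraph (Fin n)).edgeSet → Bool, gnpWeight n q x *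
            kSubsetProb n k (fun A => C.eval (x ⊔ cliqueVec A) = true)) -
        (∑ x : (⊤ : SimpleGraph (Fin n)).edgeSet → Bool,
          ∑ y : (⊤ : SimpleGraph (Fin n)).edgeSet → Bool,
            gnpWeight n q x * gnpWeight n ((n : ℝ) ^ (-ρ)) y *
              (if C.eval (x ⊔ y) = true then (1 : ℝ) else 0)) ≤
        η + Real.exp (-((n : ℝ) ^ (δ / 2))) := by
  -- adapted from `rsd_at_admissible_dose` (RossmanMonotoneCliqueRelative.lean)
  filter_upwards [thm1_sparse_relative hk' hck' hk'k hρ hδ hρδ hη] with n hn q hq0 hq1 C hC hsize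
  set E := η + Real.exp (-((n : ℝ) ^ (δ / 2))) with hE
  set p := (n : ℝ) ^ (-ρ) with hp
  -- the inner sum is `w_q(x) · Pr[C(x ∨ y) = 1]`
  have hinner : ∀ x : (⊤ : SimpleGraph (Fin n)).edgeSet → Bool,
      ∑ y : (⊤ : SimpleGraph (Fin n)).edgeSet → Bool,
          gnpWeight n q x * gnpWeight n p y * (if C.eval (x ⊔ y) = true then (1 : ℝ) else 0) =
        gnpWeight n q x * gnpProb n p (univ.filter fun y => C.eval (x ⊔ y) = true) := by
    intro x
    rw [gnpProb_filter, mul_sum]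
    refine sum_congr rfl fun y _ => ?_
    split_ifs <;> ring
  -- pointwise: `thm1_sparse_relative` times the weight of `x`
  have hpt : ∀ x : (⊤ : SimpleGraph (Fin n)).edgeSet → Bool,
      gnpWeight n q x * kSubsetProb n k (fun A => C.eval (x ⊔ cliqueVec A) = true) -
        gnpWeight n q x * gnpProb n p (univ.filter fun y => C.eval (x ⊔ y) = true) ≤
        gnpWeight n q x * E := by
    intro x
    have h := hn C hC hsize x
    rw [← mul_sub]
    exact mul_le_mul_of_nonneg_left (by linarith) (gnpWeight_nonneg hq0 hq1 x)
  -- total mass one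
  have hmass : ∑ x : (⊤ : SimpleGraph (Fin n)).edgeSet → Bool, gnpWeight n q x = 1 := by
    have := gnpProb_univ n q
    rwa [gnpProb] at this
  calc _ = ∑ x : (⊤ : SimpleGraph (Fin n)).edgeSet → Bool,
        (gnpWeight n q x * kSubsetProb n k (fun A => C.eval (x ⊔ cliqueVec A) = true) -
          gnpWeight n q x * gnpProb n p (univ.filter fun y => C.eval (x ⊔ y) = true)) := by
        rw [sum_sub_distrib]
        exact congrArg _ (sum_congr rfl fun x _ => hinner x)
    _ ≤ ∑ x : (⊤ : SimpleGraph (Fin n)).edgeSet → Bool, gnpWeight n q x * E :=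
        sum_le_sum fun x _ => hpt x
    _ = E := by rw [← sum_mul, hmass, one_mul]

end Literature.Computability.Complexity
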